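import Summits.BirchSwinnertonDyer.BirchSwinnertonDyer.Theses.SmallImageMuTransfer

/-!
# Glue item `PublishedInputsX9OfParts` of route SmallImageMuTransfer (rung K6) — one-line proof

Route `route-BirchSwinnertonDyer-SmallImageMuTransfer`, item `stmt-BirchSwinnertonDyer-19462`
(support, rank 908, GLUE of the by-name alias split of `PublishedInputsX9`, rev 7 commit 4e87ab025eff):
`BCSCharIdealEqPadicLFunction → GreenbergCharValueRankZero → RealPeriodUnitPlusPeriod →
IwasawaLeadingTermFactsX9 → ModularParametrizationSupply → EntireLFunctionRat → RankEqAnalyticRankLeOne →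
PublishedInputsX9`. Each child is a conjunct of `PublishedInputsX9` by name (the fourth child is the
conjunction Schneider 1985 ∧ Perrin-Riou 1987), so the glue is the anonymous constructor. Bookkeeping
only: credits nothing toward the open cruxes. READY file by the tenure planner (bsd-smallim-plan g5);
a prover files it with `--workitem stmt-BirchSwinnertonDyer-19462`.
-/

set_option linter.dupNamespace false

namespace Summit.BirchSwinnertonDyer.BirchSwinnertonDyer.Theorems

/-- The glue item of the alias split of `PublishedInputsX9`, literally the route decl. -/
theorem smallImageMuTransfer_PublishedInputsX9OfParts_proof :
    Summit.BirchSwinnertonDyer.BirchSwinnertonDyer.Theses.SmallImageMuTransfer.PublishedInputsX9OfParts :=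
  fun h1 h2 h3 h45 h6 h7 h8 => ⟨h1, h2, h3, h45.1, h45.2, h6, h7, h8⟩

end Summit.BirchSwinnertonDyer.BirchSwinnertonDyer.Theorems
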